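import Summits.CriticalPhenomena.Ising3DConformalLimit.Theses.PrecisionLaplacian

/-!
# Lévy-side dictionary for crux `StableConeRPRigidity` (stmt-CriticalPhenomena-4800) — checked bookkeeping

Crux-plan seat `planner-cruxplan-stmt-CriticalPhenomena-4800-levy-side-linearisat-0` (2026-08-16), idea card
`Cruxes/StableConeRPRigidity/Ideas/levy-side-linearisation.md` (gen-1, refreshed by gen-2 at 00:20Z).

**Verdict of the crux-plan: NO concluding skeleton** for this idea (see `Lines/levy-side-linearisation.md`).  The
Lévy-side statement `LevyKernelRigidity` ("the Lévy kernel `J_Φ = ‖z‖^(-(3+α)) Φ(ẑ)` nine-mirror RP ⇒ `Φ` constant") is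
EQUIVALENT to the crux (Disproof.lean §R; three triagers), the Lévy weight `3 + α ∈ [4,5)` lies OUTSIDE the window
`β < 4` of the lead line `riesz-probe-xray-mellin`, and every closer available on the Lévy side is either that line run
on the potential side (where the Lévy lever is not load-bearing) or a stub equivalent to the crux by the five-line
convexity argument `constOnSphere_of_local` below.  What this file records instead, kernel-checked and sorry-free, is the
LOGIC of the idea's three genuine deliverables, each modulo named analytic statements (`Prop`s, not proved here):

* `crux_of_levyKernelRigidity`  — `DescentKJ → IsotropicOfProfileConst → LevyKernelRigidity → StableConeRPRigidity`
  (the Lévy-side form decides the crux; `DescentKJ` = the card's First lemma, RP descends `K → J_Φ`, mirror by mirror).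
* `levyKernelRigidity_of_crux`  — `PotentialKernelExists → AscentJK → ProfileConstOfIsotropic → StableConeRPRigidity →
  LevyKernelRigidity` (the EXPORT of the refreshed card, "Why it bites (ii)": once the crux is proved — e.g. by the lead line,
  which proves nine-mirror rigidity for degrees in `(-4, 0)` — rigidity holds for every non-negative continuous angular
  profile in Lévy degrees `(-5, -4]`, a window no extinction argument reaches; `AscentJK` is the SOLID direction
  `RP(J_Φ) ⇒ RP(K)`, FILS78 "RP couplings ⇒ RP covariance").
* `constOnSphere_of_local`      — card (L1) CONVEXITY made effective, at ANY weight `w` where the Riesz kernel `‖z‖^(-w)` is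
  nine-RP (`w ≥ 1`): local rigidity at the isotropic point (profiles `δ`-close to `1`, any fixed `δ > 0`) implies global
  rigidity, because `(1-t)·1 + t·Φ` stays in the nine-RP cone.  PROVED here (no sorry).  Corollary
  `levyKernelRigidity_of_local`.  NB this is side-agnostic (the nine-RP cone is convex at every weight), which is one of
  the reasons it does not make a Lévy-side line.
* `rigid_mono`                  — weight bookkeeping: Schur products with `‖z‖^(-γ)`, `γ ≥ 1` (`SchurRiesz`, = the lead
  card's S1) move kernels UP in weight, so rigidity propagates DOWN by steps `≥ 1`; with the two descent directions this
  gives the reciprocity `crux(α) ⇔ Rigid(3-α) ⇔ Rigid(3+α)` recorded in the line card (the Lévy side is the HARD side).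

Vocabulary (`IsMirror`, `MirrorInv`, `RP`, …) is the crux's own clauses, copied rather than imported from the disprover's
moving work file `Disproof.lean`; `crux_iff` re-bundles the crux by name.
-/

namespace Summit.CriticalPhenomena.Ising3DConformalLimit.Cruxes.StableConeRPRigidity.LevySide

open scoped BigOperators
open Summit.CriticalPhenomena.Ising3DConformalLimit.Theses

set_option linter.unusedVariables false

/-- Ambient space `ℝ³`. -/
abbrev E := EuclideanSpace ℝ (Fin 3)

/-! ## Vocabulary (verbatim clauses of the crux) -/

/-- `n` is one of the nine lattice mirror normals `eᵢ`, `eᵢ + eⱼ`, `eᵢ - eⱼ` (the crux's clause). -/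
def IsMirror (n : E) : Prop :=
  ∃ i j : Fin 3, i ≠ j ∧ (n = EuclideanSpace.single i 1 ∨ n = EuclideanSpace.single i 1 + EuclideanSpace.single j 1 ∨
    n = EuclideanSpace.single i 1 - EuclideanSpace.single j 1)

/-- Mirror invariance `K ∘ θ_n = K`. -/
def MirrorInv (K : E → ℝ) (n : E) : Prop := ∀ x, K (((ℝ ∙ n)ᗮ).reflection x) = K x

/-- Reflection positivity in the mirror `n` (finite sums over points of the open half-space), the crux's clause. -/
def RP (K : E → ℝ) (n : E) : Prop :=
  ∀ (m : ℕ) (p : Fin m → E) (c : Fin m → ℝ), (∀ a, 0 < inner ℝ (p a) n) →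
    0 ≤ ∑ a, ∑ b, c a * c b * K (p a - ((ℝ ∙ n)ᗮ).reflection (p b))

/-- Nine-mirror invariance and reflection positivity (the crux's mirror clause, bundled). -/
def NineRP (K : E → ℝ) : Prop := ∀ n, IsMirror n → MirrorInv K n ∧ RP K n

/-- `O(3)`-invariance (the crux's conclusion). -/
def Isotropic (K : E → ℝ) : Prop := ∀ (R : E ≃ₗᵢ[ℝ] E) (x : E), K (R x) = K x

/-- Positive homogeneity of degree `β`. -/
def Homog (β : ℝ) (K : E → ℝ) : Prop := ∀ c : ℝ, 0 < c → ∀ x, K (c • x) = c ^ β * K x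

/-- The Fourier-free potential equation `K ∗ (L_Φ f) = -f` of the crux. -/
def PotentialEq (α : ℝ) (Φ K : E → ℝ) : Prop :=
  ∀ f : E → ℝ, ContDiff ℝ 2 f → HasCompactSupport f → ∀ x,
    (∫ y, K (x - y) * ((1/2 : ℝ) * ∫ z, (f (y + z) + f (y - z) - 2 * f y) * (‖z‖ ^ (-(3 + α)) * Φ (‖z‖⁻¹ • z)))) = - f x

/-- Admissible angular Lévy profile: continuous, `≥ 0`, `≢ 0` on the unit sphere, even. -/
def AdmissibleProfile (Φ : E → ℝ) : Prop :=
  ContinuousOn Φ (Metric.sphere 0 1) ∧ (∀ u ∈ Metric.sphere (0 : E) 1, 0 ≤ Φ u) ∧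
    (∃ u ∈ Metric.sphere (0 : E) 1, 0 < Φ u) ∧ ∀ u, Φ (-u) = Φ u

/-- Positive continuous kernel on `ℝ³ ∖ 0`. -/
def PosKernel (K : E → ℝ) : Prop := ContinuousOn K {0}ᶜ ∧ ∀ x, x ≠ 0 → 0 < K x

/-- All hypotheses of the crux on the triple `(α, Φ, K)` except the mirror clause. -/
def StableTriple (α : ℝ) (Φ K : E → ℝ) : Prop :=
  1 ≤ α ∧ α < 2 ∧ AdmissibleProfile Φ ∧ PosKernel K ∧ Homog (α - 3) K ∧ PotentialEq α Φ K

/-- `Φ` is constant on the unit sphere. -/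
def ConstOnSphere (Φ : E → ℝ) : Prop :=
  ∀ u ∈ Metric.sphere (0 : E) 1, ∀ v ∈ Metric.sphere (0 : E) 1, Φ u = Φ v

/-- The homogeneous kernel of weight `w` with angular profile `Φ`: `‖z‖^(-w) Φ(z/‖z‖)`. -/
noncomputable def profileKernel (w : ℝ) (Φ : E → ℝ) (z : E) : ℝ := ‖z‖ ^ (-w) * Φ (‖z‖⁻¹ • z)

/-- The LÉVY KERNEL of the stable cone, `J_Φ(z) = ‖z‖^(-(3+α)) Φ(ẑ)` (density of the Lévy measure). -/
noncomputable def levyKernel (α : ℝ) (Φ : E → ℝ) : E → ℝ := profileKernel (3 + α) Φ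

theorem levyKernel_apply (α : ℝ) (Φ : E → ℝ) (z : E) :
    levyKernel α Φ z = ‖z‖ ^ (-(3 + α)) * Φ (‖z‖⁻¹ • z) := rfl

/-- The crux with its hypotheses bundled (pure bookkeeping, by name). -/
theorem crux_iff :
    PrecisionLaplacian.StableConeRPRigidity ↔
      ∀ (α : ℝ) (Φ K : E → ℝ), StableTriple α Φ K → NineRP K → Isotropic K := by
  constructor
  · intro h α Φ K hT hN R x
    obtain ⟨h1, h2, ⟨hc, hnn, hpos, hev⟩, ⟨hKc, hKp⟩, hhom, hpot⟩ := hT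
    exact h α Φ K h1 h2 hc hnn hpos hev hKc hKp hhom hpot (fun n hn => hN n hn) R x
  · intro h α Φ K h1 h2 hc hnn hpos hev hKc hKp hhom hpot hmir R x
    exact h α Φ K ⟨h1, h2, ⟨hc, hnn, hpos, hev⟩, ⟨hKc, hKp⟩, hhom, hpot⟩ (fun n hn => hmir n hn) R x

/-! ## The dictionary (analytic statements; NOT proved here — their status is discussed in the line card) -/

/-- DESCENT `K → J_Φ` (the card's First lemma, = Disproof §R (R2), = card jump-kernel-transverse-monotonicity's
`JumpKernelInheritsRP`, with the invariance half added): for a stable triple and ONE lattice mirror `n`, mirror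
invariance and RP of the potential kernel `K` pass to the Lévy kernel `J_Φ`.  Mechanism: polarised Bernstein step ⇒
Laplace–Fourier representation of `K` on the half-space ⇒ sections `s ↦ K̂(√s n + ξ) = 1/ψ_Φ` Stieltjes ⇒ `ψ_Φ`-sections
complete Bernstein WITHOUT linear term (`α < 2`) ⇒ the transverse cosine transform of `J_Φ(tn + ·)` is completely
monotone ⇒ `RP_n(J_Φ)`; invariance: `ψ_Φ ∘ θ_n = ψ_Φ` and injectivity of the `α`-cosine transform on even functions
(`α ∉ 2ℕ`, Funk–Hecke).  Size L in Lean.  In-tree engines (all PROVED): the Laplace representation of symmetric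
contraction semigroups `Literature.Analysis.OperatorTheory.SymmContractionSemigroup.exists_laplace_measure` (the
operator form of Bernstein–Widder, reached from an RP kernel by the GNS/RKHS construction), the joint energy–momentum
measure `Literature.Analysis.OperatorTheory.IsEnergyMomentumPair.exists_measure_inner_transfer_translate_eq_integral`,
Bochner `Literature.Analysis.FunctionSpaces.IsPositiveDefinite.exists_charFun_eq_holds`, Nevanlinna
`Literature.Analysis.Complex.nevanlinna_representation_holds` and the Stieltjes class `(S)`
`Literature.Analysis.InverseSpectral.isNevanlinnaStieltjes_of_nevanlinna_representation`; missing: the GNS step itself,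
the CBF ⇔ `1/f` Stieltjes dictionary (SSV Thm 7.3) and the Fourier analysis of homogeneous kernels (`K̂ = 1/ψ_Φ`). -/
def DescentKJ : Prop :=
  ∀ (α : ℝ) (Φ K : E → ℝ) (n : E), StableTriple α Φ K → IsMirror n →
    MirrorInv K n → RP K n → MirrorInv (levyKernel α Φ) n ∧ RP (levyKernel α Φ) n

/-- ASCENT `J_Φ → K` (the SOLID direction, FILS78 §3 "RP couplings ⇒ RP Gaussian state ⇒ RP covariance", two-line CBF
computation of the refreshed card: `ψ(k_n n+ξ) = ψ(ξ) + ∫ 2s/(λ(λ²+s)) μ_ξ(dλ)` is CBF, `1/ψ` Stieltjes, `K̂ = 1/ψ_Φ`):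
for a stable triple and one lattice mirror, invariance and RP of `J_Φ` pass to `K`. -/
def AscentJK : Prop :=
  ∀ (α : ℝ) (Φ K : E → ℝ) (n : E), StableTriple α Φ K → IsMirror n →
    MirrorInv (levyKernel α Φ) n → RP (levyKernel α Φ) n → MirrorInv K n ∧ RP K n

/-- EXISTENCE of the potential kernel (Bogdan–Sztonyk / Fourier: `K = 𝓕⁻¹[1/ψ_Φ]`, `ψ_Φ(k) = c_α ∫ |k·u|^α Φ(u) dσ(u) > 0`
off `0` since `Φ ≢ 0`): every admissible profile has a continuous, positive, degree-`(α-3)` homogeneous kernel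
satisfying the crux's potential equation.  (Used only by the export.) -/
def PotentialKernelExists : Prop :=
  ∀ (α : ℝ) (Φ : E → ℝ), 1 ≤ α → α < 2 → AdmissibleProfile Φ →
    ∃ K : E → ℝ, PosKernel K ∧ Homog (α - 3) K ∧ PotentialEq α Φ K

/-- `K` isotropic ⇒ `Φ` constant on the sphere (`K̂ = 1/ψ_Φ` radial ⇒ `ψ_Φ` radial ⇒ `Φ` constant by injectivity of the
`α`-cosine transform on even continuous functions, `α ∉ 2ℕ`).  (Used only by the export.) -/
def ProfileConstOfIsotropic : Prop :=
  ∀ (α : ℝ) (Φ K : E → ℝ), StableTriple α Φ K → Isotropic K → ConstOnSphere Φ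

/-- `Φ` constant on the sphere ⇒ `K` isotropic (uniqueness of the tempered homogeneous fundamental solution of `L_Φ`:
for constant `Φ`, `K ∘ R` solves the same potential equation for every isometry `R`; Disproof §0 "K is UNIQUELY
determined by `(α, Φ)`"). -/
def IsotropicOfProfileConst : Prop :=
  ∀ (α : ℝ) (Φ K : E → ℝ), StableTriple α Φ K → ConstOnSphere Φ → Isotropic K

/-- THE LÉVY-SIDE FORM OF THE CRUX (Disproof §R (R2) `LevyKernelRigidity`, here with invariance bundled into `NineRP`):
an admissible profile whose Lévy kernel is nine-mirror invariant and RP is constant.  Equivalent to the crux modulo the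
dictionary (`crux_of_levyKernelRigidity`, `levyKernelRigidity_of_crux`).  Weight `3 + α ∈ [4,5)`: OUTSIDE the window
`β < 4` of line riesz-probe-xray-mellin — this is the export territory, not a shortcut. -/
def LevyKernelRigidity : Prop :=
  ∀ (α : ℝ) (Φ : E → ℝ), 1 ≤ α → α < 2 → AdmissibleProfile Φ → NineRP (levyKernel α Φ) → ConstOnSphere Φ

/-! ## Checked compositions -/

/-- The Lévy-side form decides the crux, given the descent `K → J_Φ` and uniqueness of `K` for constant profiles. -/
theorem crux_of_levyKernelRigidity (hD : DescentKJ) (hI : IsotropicOfProfileConst) (h : LevyKernelRigidity) :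
    PrecisionLaplacian.StableConeRPRigidity := by
  rw [crux_iff]
  intro α Φ K hT hN
  have hJ : NineRP (levyKernel α Φ) := fun n hn => hD α Φ K n hT hn (hN n hn).1 (hN n hn).2
  exact hI α Φ K hT (h α Φ hT.1 hT.2.1 hT.2.2.1 hJ)

/-- EXPORT (refreshed card, "Why it bites (ii)" / Transfer): the crux implies nine-mirror rigidity for every admissible
profile in Lévy degrees `-(3+α) ∈ (-5,-4]`, given existence of the potential kernel, the ascent `J_Φ → K` and
`K` isotropic ⇒ `Φ` constant. -/
theorem levyKernelRigidity_of_crux (hE : PotentialKernelExists) (hA : AscentJK) (hP : ProfileConstOfIsotropic)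
    (h : PrecisionLaplacian.StableConeRPRigidity) : LevyKernelRigidity := by
  intro α Φ h1 h2 hΦ hJ
  obtain ⟨K, hK, hhom, hpot⟩ := hE α Φ h1 h2 hΦ
  have hT : StableTriple α Φ K := ⟨h1, h2, hΦ, hK, hhom, hpot⟩
  have hN : NineRP K := fun n hn => hA α Φ K n hT hn (hJ n hn).1 (hJ n hn).2
  exact hP α Φ K hT (crux_iff.mp h α Φ K hT hN)

/-! ## Convexity: local rigidity at the isotropic point suffices (card (L1), made effective; PROVED) -/

/-- **Local rigidity suffices.**  Fix a weight `w` at which the Riesz kernel `‖z‖^(-w)` is nine-mirror invariant and RP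
(true iff `w ≥ 1`, the unitarity bound in `ℝ³`).  If every continuous profile `Ψ` that is `δ`-close to `1` on the sphere
and has a nine-RP kernel of weight `w` is constant on the sphere, then EVERY continuous profile with a nine-RP kernel of
weight `w` is constant on the sphere.  Proof: the nine-RP cone is convex and contains the Riesz kernel, so
`Ψ_t := (1-t) + tΦ` is admissible for `t ∈ (0,1]` and `δ`-close to `1` for `t ≤ δ / (sup|Φ-1| + δ)`. -/
theorem constOnSphere_of_local {w δ : ℝ} (hδ : 0 < δ)
    (hRiesz : NineRP (fun z : E => ‖z‖ ^ (-w)))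
    (hloc : ∀ Ψ : E → ℝ, ContinuousOn Ψ (Metric.sphere 0 1) →
      (∀ u ∈ Metric.sphere (0 : E) 1, |Ψ u - 1| ≤ δ) → NineRP (profileKernel w Ψ) → ConstOnSphere Ψ)
    (Φ : E → ℝ) (hΦ : ContinuousOn Φ (Metric.sphere 0 1)) (hK : NineRP (profileKernel w Φ)) :
    ConstOnSphere Φ := by
  -- a bound `M` for `|Φ - 1|` on the compact sphere
  obtain ⟨M, hM0, hM⟩ : ∃ M : ℝ, 0 ≤ M ∧ ∀ u ∈ Metric.sphere (0 : E) 1, |Φ u - 1| ≤ M := by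
    rcases (Metric.sphere (0 : E) 1).eq_empty_or_nonempty with he | hne
    · refine ⟨0, le_rfl, fun u hu => ?_⟩
      rw [he] at hu
      simp at hu
    · have hc : ContinuousOn (fun u => |Φ u - 1|) (Metric.sphere (0 : E) 1) :=
        continuous_abs.comp_continuousOn (hΦ.sub continuousOn_const)
      obtain ⟨u₀, hu₀, hmax⟩ := (isCompact_sphere (0 : E) 1).exists_isMaxOn hne hc
      exact ⟨|Φ u₀ - 1|, abs_nonneg _, fun u hu => (isMaxOn_iff.mp hmax) u hu⟩
  -- the interpolation parameter
  have hMδ : 0 < M + δ := by linarith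
  set t : ℝ := δ / (M + δ) with ht
  have ht0 : 0 < t := div_pos hδ hMδ
  have ht1 : t ≤ 1 := by
    rw [ht, div_le_one hMδ]; linarith
  have htM : t * M ≤ δ := by
    rw [ht, div_mul_eq_mul_div, div_le_iff₀ hMδ]; nlinarith
  -- the interpolated profile `Ψ = (1-t) + tΦ`
  set Ψ : E → ℝ := fun u => (1 - t) + t * Φ u with hΨ
  have hΨc : ContinuousOn Ψ (Metric.sphere 0 1) := continuousOn_const.add (continuousOn_const.mul hΦ)
  have hΨδ : ∀ u ∈ Metric.sphere (0 : E) 1, |Ψ u - 1| ≤ δ := by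
    intro u hu
    have e : Ψ u - 1 = t * (Φ u - 1) := by simp only [hΨ]; ring
    rw [e, abs_mul, abs_of_pos ht0]
    exact (mul_le_mul_of_nonneg_left (hM u hu) ht0.le).trans htM
  -- convexity of the nine-RP cone: `Ψ`-kernel = (1-t)·Riesz + t·(Φ-kernel)
  have key : ∀ z : E, profileKernel w Ψ z = (1 - t) * ‖z‖ ^ (-w) + t * profileKernel w Φ z := by
    intro z; simp only [profileKernel, hΨ]; ring
  have hΨK : NineRP (profileKernel w Ψ) := by
    intro n hn
    obtain ⟨hRi, hRr⟩ := hRiesz n hn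
    obtain ⟨hKi, hKr⟩ := hK n hn
    have hRi' : ∀ x : E, ‖((ℝ ∙ n)ᗮ).reflection x‖ ^ (-w) = ‖x‖ ^ (-w) := fun x => hRi x
    refine ⟨fun x => ?_, fun m p c hp => ?_⟩
    · rw [key, key, hRi' x, hKi x]
    · have h1 : 0 ≤ ∑ a, ∑ b, c a * c b * ‖p a - ((ℝ ∙ n)ᗮ).reflection (p b)‖ ^ (-w) := hRr m p c hp
      have h2 : 0 ≤ ∑ a, ∑ b, c a * c b * profileKernel w Φ (p a - ((ℝ ∙ n)ᗮ).reflection (p b)) :=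
        hKr m p c hp
      have e : ∀ a b : Fin m, c a * c b * profileKernel w Ψ (p a - ((ℝ ∙ n)ᗮ).reflection (p b)) =
          (1 - t) * (c a * c b * ‖p a - ((ℝ ∙ n)ᗮ).reflection (p b)‖ ^ (-w)) +
          t * (c a * c b * profileKernel w Φ (p a - ((ℝ ∙ n)ᗮ).reflection (p b))) := by
        intro a b; rw [key]; ring
      have hsplit : ∑ a, ∑ b, c a * c b * profileKernel w Ψ (p a - ((ℝ ∙ n)ᗮ).reflection (p b)) =
          (1 - t) * ∑ a, ∑ b, c a * c b * ‖p a - ((ℝ ∙ n)ᗮ).reflection (p b)‖ ^ (-w) +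
          t * ∑ a, ∑ b, c a * c b * profileKernel w Φ (p a - ((ℝ ∙ n)ᗮ).reflection (p b)) := by
        simp only [e, Finset.sum_add_distrib, ← Finset.mul_sum]
      rw [hsplit]
      have ht1' : 0 ≤ 1 - t := by linarith
      exact add_nonneg (mul_nonneg ht1' h1) (mul_nonneg ht0.le h2)
  -- conclude
  have hconst := hloc Ψ hΨc hΨδ hΨK
  intro u hu v hv
  have huv := hconst u hu v hv
  simp only [hΨ] at huv
  have : t * Φ u = t * Φ v := by linarith
  exact mul_left_cancel₀ ht0.ne' this

/-- The Riesz kernels `‖z‖^(-w)`, `w ≥ 1`, are nine-mirror invariant and RP (FILS78 §2–3 / FrankLieb2010: `‖x‖^(-s)` is RP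
iff `s ≥ d - 2 = 1`; Yukawa mixtures `∫ m^(w-2) e^(-m‖x‖)/‖x‖ dm` for `w > 1`; the lead card's S1 input, its toy j007729
confirms the threshold numerically). -/
def RieszNineRP : Prop := ∀ w : ℝ, 1 ≤ w → NineRP (fun z : E => ‖z‖ ^ (-w))

/-- LOCAL LÉVY RIGIDITY (the perturbative regime of `LevyKernelRigidity`: profiles `δ`-close to the isotropic one, `δ` at
the prover's disposal).  By `levyKernelRigidity_of_local` it already gives `LevyKernelRigidity`; recorded, NOT filed as a
stub: it is the crux in its perturbative costume (equivalent by the five-line convexity argument), see the line card. -/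
def LocalLevyRigidity : Prop :=
  ∀ α : ℝ, 1 ≤ α → α < 2 → ∃ δ : ℝ, 0 < δ ∧ ∀ Ψ : E → ℝ, ContinuousOn Ψ (Metric.sphere 0 1) →
    (∀ u ∈ Metric.sphere (0 : E) 1, |Ψ u - 1| ≤ δ) → NineRP (levyKernel α Ψ) → ConstOnSphere Ψ

/-- Perturbative ⇒ global on the Lévy side (weights `3 + α ≥ 4 ≥ 1`). -/
theorem levyKernelRigidity_of_local (hR : RieszNineRP) (hL : LocalLevyRigidity) : LevyKernelRigidity := by
  intro α Φ h1 h2 hΦ hJ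
  obtain ⟨δ, hδ, hloc⟩ := hL α h1 h2
  exact constOnSphere_of_local hδ (hR (3 + α) (by linarith)) hloc Φ hΦ.1 hJ

/-! ## Weight bookkeeping: Schur products move kernels up, rigidity propagates down -/

/-- SCHUR–RIESZ (= lead card S1, `SchurRieszProbe`): the Hadamard product of the Gram matrices of a nine-RP kernel and of
`‖z‖^(-γ)`, `γ ≥ 1`, is PSD (Schur product theorem), so `‖z‖^(-γ) ·` preserves the nine-RP cone; in profile form the
weight goes UP by `γ`. -/
def SchurRiesz : Prop :=
  ∀ (w γ : ℝ) (Ψ : E → ℝ), 1 ≤ γ → NineRP (profileKernel w Ψ) → NineRP (profileKernel (w + γ) Ψ)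

/-- Nine-mirror rigidity at weight `w` for continuous angular profiles (no sign condition; the item-1979 / lead-card form
asks `K > 0`, the Lévy form asks `Φ ≥ 0` — by `constOnSphere_of_local` these variants agree wherever the Riesz kernel is RP). -/
def Rigid (w : ℝ) : Prop :=
  ∀ Φ : E → ℝ, ContinuousOn Φ (Metric.sphere 0 1) → NineRP (profileKernel w Φ) → ConstOnSphere Φ

/-- Rigidity propagates DOWNWARD in the weight by steps `≥ 1`: the Lévy side (`3 + α`) is the hard side, the potential
side (`3 - α`) the easy one; with `DescentKJ`/`AscentJK` (weight `3 - α ↔ 3 + α`) this yields the reciprocity of the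
line card: rigidity at ONE weight in `(1,5)` ⇔ at all of them ⇔ the crux ⇔ item 1979. -/
theorem rigid_mono (hS : SchurRiesz) {w v : ℝ} (hvw : v + 1 ≤ w) (h : Rigid w) : Rigid v := by
  intro Φ hΦ hK
  have hγ : (1 : ℝ) ≤ w - v := by linarith
  have hK' : NineRP (profileKernel (v + (w - v)) Φ) := hS v (w - v) Φ hγ hK
  have e : v + (w - v) = w := by ring
  rw [e] at hK'
  exact h Φ hΦ hK'

/-- The Lévy-side form is `Rigid (3 + α)` restricted to admissible profiles. -/
theorem levyKernelRigidity_of_rigid (h : ∀ α : ℝ, 1 ≤ α → α < 2 → Rigid (3 + α)) : LevyKernelRigidity :=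
  fun α Φ h1 h2 hΦ hJ => h α h1 h2 Φ hΦ.1 hJ

end Summit.CriticalPhenomena.Ising3DConformalLimit.Cruxes.StableConeRPRigidity.LevySide
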